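import Summits.ResolutionOfSingularities.ResolutionOfSingularities.Theorems.EquisingularLiftEquisingularLiftNatTowerCechRoundCloserRoot
import Summits.ResolutionOfSingularities.ResolutionOfSingularities.Theorems.EquisingularLiftEquisingularLiftNatTowerCechRootCentre
import Summits.ResolutionOfSingularities.ResolutionOfSingularities.Theorems.EquisingularLiftEquisingularLiftNatTowerRootsDischarge
import HarnessLib

/-!
# [OURS · L1 W4.5(b) · EL♮(3)] HSUB′(ReachTower₃) — THE ASSEMBLY'S STAND-IN S6 `hCech`, CLOSED MODULO (N1) / (N3) / (N3′) / S2 — v2, closers at the LIFT (L)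
# (= …NatTowerCechRoundCloser with the round's data `Z ⊆ E ∩ T`, `Z ≠ ∅`, `TowerFull`, `¬ T ⊆ E` ADDED to (N1)'s antecedents, so that (N1) is
# dischargeable: …NatTowerCechCentre's `Tower.hCentre_of_root` produces exactly this (N1) from a centre at the root of `DirLift.Ruled`)
# (res-D-pv-029's `hCech` binder of `D/res-D-pv-029/gen8/TowerAssembly.lean` = the S6 STATEMENT OF RECORD, res-L1-w45b-plan-1 2026-08-27T20:21:03Z (2))

res-D-pv-057 g9 AS a w45b hand. OURS; NOT a statement of any manuscript; AI-written, weaker than expert review. No `sorry`; standard axioms. DEF-FREE.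
`--supports stmt-ResolutionOfSingularities-20148 --as helper`. Closer-modulo pattern (like p564140): the conclusion of **`Tower.hCech_of`** is the `hCech`
binder of the assembly `hsub_reachTower_three_of` VERBATIM, so the assembly may pass `Tower.hCech_of₃ … hCentre hShadow hShadowOld hRootRound` in its slot
(v1 `Tower.hCech_of`, p569903, has the same conclusion but an (N1) WITHOUT the round's data among its antecedents — too strong to discharge, superseded here);
the four remaining hypotheses are
* (N1) `hCentre` — the Čech centre `𝒞 = 𝓔 ⊔ 𝒦₁` at a Čech-witnessed stage (res-L1-w45b-stub-2's S6 decomposition (a)–(d), next file `…NatTransportedCentre`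
  over T-DIRLIFT / DIRDICT (a) / T-DIRLIFT-UP / T-CENTRE-2FRAME / the bridge p567357);
* (N3) `hShadow`, (N3′) `hShadowOld` — the transported shadow `St_𝒞 𝒦` next to the new / old surface after a Čech round OFF the shadow
  (`closure (Z ∖ closure K) = Z`; (k-ii)–(k-vi) of `Tower.Shadow₂`; owner res-D-pv-051 / stub-2);
* S2 `hRootRound` — the assembly's own stand-in (ruled-surface datum born at a CONE round), used only in the cone-witnessed sub-case of the driver's `K′`
  menu, which is dispatched to res-D-pv-029's `Tower.inv₂_coneRound_new` / `_old` (p558403 / p560701) with stub-2's S4/S5 (p564910) discharging their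
  `hRuled` / `hEZ`.
Everything else — the two `Tower.Inv₂` conclusions (…NatTowerCechRound / …NatTowerCechRoundOld) and the downstairs side facts of `K′` (res-D-pv-029's
…NatTowerSideFacts) — is in the tree.
-/

set_option linter.dupNamespace false -- mandated namespace `Summit.<Summit>.<Problem>` of this single-conjunct summit
set_option linter.overlappingInstances false -- signatures carry `[IsDomain O] [IsDiscreteValuationRing O]`

noncomputable section

open CategoryTheory CategoryTheory.Limits AlgebraicGeometry TopologicalSpace Topology IsLocalRing
open Literature.AlgebraicGeometry.Resolution
open Literature.AlgebraicGeometry.Morphisms (ProjCech.PP ProjCech.toSpec)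
open AlgebraicGeometry.Scheme.IdealSheafData
open Summit.ResolutionOfSingularities.ResolutionOfSingularities.Theses.EquisingularLift.Split
open Summit.ResolutionOfSingularities.ResolutionOfSingularities.Cruxes.EquisingularLift.StrataSplit

namespace Summit.ResolutionOfSingularities.ResolutionOfSingularities.Cruxes.EquisingularLiftNat.Sections

set_option maxHeartbeats 1600000 in -- long binder texts
/-- **S6 `hCech` closed modulo the DIRECTION LIFT (L), the two shadow stand-ins (N3)/(N3′) and S2**: `Tower.hCech_of_root` with (N1°) supplied by
…NatTowerCechRootCentre's `Tower.hRootCentre_of_lift`. (L) is T-DIRLIFT-UP's conclusion block (res-D-pv-051) at the root of `DirLift.Ruled`, fed with the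
pushed section. [OURS · L1 W4.5b] toward `stub_elnat_coneTowerPointResolution` (stmt-ResolutionOfSingularities-20148 / -20038); NOT a statement of the
manuscript. -/
theorem Tower.hCech_of_lift (O : Type) [CommRing O] [IsDomain O] [IsDiscreteValuationRing O] (k : Type) [Field k]
    (θ : O →+* k) (hθ : Function.Surjective θ)
    (P : Scheme.{0}) (q : P ⟶ Spec (.of O)) (hqprop : IsProper q) (Y : Set P) (hYirr : IsIrreducible Y) (hYcl : IsClosed Y)
    (hPnoeth : IsLocallyNoetherian P) (hPreg : Scheme.IsRegular P)
    (Ch : ∀ X' : Scheme.{0}, (X' ⟶ P) → Set X' → Prop)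
    (hChain : ∀ (X' : Scheme.{0}) (σ : X' ⟶ P) (S : Set X'), Ch X' σ S → Chain P Y X' σ S)
    (hStep : ∀ (X' X'' : Scheme.{0}) (σ' : X' ⟶ P) (S' : Set X') (C : X'.IdealSheafData) (τ : X'' ⟶ X'),
      Ch X' σ' S' → IsBlowup τ C → Scheme.IsRegular C.subscheme → Flat (C.subschemeι ≫ σ' ≫ q) →
      σ' '' (C.support : Set X') ⊆ {x : P | ¬ IsGenericPoint x Y} →
      (C.support : Set X') ∩ (σ' ≫ q) ⁻¹' {IsLocalRing.closedPoint O} ⊆ S' →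
      Ch X'' (τ ≫ σ') (closure (τ ⁻¹' (S' \ (C.support : Set X')))))
    -- (L) the direction lift at the root (T-DIRLIFT-UP's conclusion, frames at every point of `V(I)`)
    (hLift : ∀ {F₉ : Scheme.{0}} (Z₉ : Set F₉) (hZ₉ : IsClosed Z₉)
        (G : Scheme.{0}) (E : Set G) (hE : IsClosed E) (Z : Set G) (hZ : IsClosed Z)
        (X₀ : Scheme.{0}) (σ₀ : X₀ ⟶ P) (I : X₀.IdealSheafData) (G₀ : Scheme.{0}) (j₀ : G₀ ⟶ X₀) (t₀ : G₀ ⟶ Spec (.of k))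
        (Z₀ : Set G₀) (hZ₀ : IsClosed Z₀) (G₁ : Scheme.{0}) (υ₁ : G₁ ⟶ G₀) (ϱ : G ⟶ G₁)
        (E₁ : Set G₁) (hE₁ : IsClosed E₁) (Γ₁ : Set G₁) (hΓ₁ : IsClosed Γ₁)
        (ε : redSub G E hE ⟶ redSub G₁ E₁ hE₁) (εZ : redSub G Z hZ ⟶ redSub G₁ Γ₁ hΓ₁) (𝒟' : G₀.IdealSheafData),
        -- the root (R1)–(R4)
        IsIntegral X₀ → IsLocallyNoetherian X₀ → Scheme.IsRegular X₀ →
        IsPullback j₀ t₀ (σ₀ ≫ q) (Spec.map (CommRingCat.ofHom θ)) →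
        Scheme.IsRegular I.subscheme → Flat (I.subschemeι ≫ σ₀ ≫ q) →
        (∀ x ∈ I.support, ∃ c : Fin 2 → X₀.presheaf.stalk x, Ideal.span (Set.range c) = stalkIdeal I x ∧ IsQuasiRegular c) →
        RationalCarrier (redSub F₉ Z₉ hZ₉) →
        (RationalCarrier (redSub F₉ Z₉ hZ₉) → ∃ e₁ : I.subscheme ≅ ProjCech.PP O 1, e₁.hom ≫ ProjCech.toSpec O 1 = I.subschemeι ≫ σ₀ ≫ q) →
        I.comap j₀ = vanishingIdeal ⟨Z₀, hZ₀⟩ →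
        -- the downstairs round at the root: blow-up of the carrier trace, the pushed section `Γ₁ ⊆ E₁ = υ₁⁻¹Z₀`
        IsBlowup υ₁ (vanishingIdeal (⟨Z₀, hZ₀⟩ : Closeds G₀)) → E₁ = υ₁ ⁻¹' Z₀ → Γ₁ ⊆ E₁ → Γ₁ = ϱ '' Z → Z ⊆ E →
        (∃ δ₁ : redSub G₁ Γ₁ hΓ₁ ⟶ redSub G₀ Z₀ hZ₀, δ₁ ≫ redSubι G₀ Z₀ hZ₀ = redSubι G₁ Γ₁ hΓ₁ ≫ υ₁ ∧ IsIso δ₁) →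
        (∀ (i₁ : redSub G₁ Γ₁ hΓ₁ ⟶ redSub G₁ E₁ hE₁), i₁ ≫ redSubι G₁ E₁ hE₁ = redSubι G₁ Γ₁ hΓ₁ →
          ∀ x₁ : redSub G₁ Γ₁ hΓ₁, IsRegularLocalRing ((redSub G₁ E₁ hE₁).presheaf.stalk (i₁ x₁))) →
        -- the stage's unobstructedness datum, handed with the special-fibre isomorphisms (exceptional pair abstracted)
        IsIso ε → ε ≫ redSubι G₁ E₁ hE₁ = redSubι G E hE ≫ ϱ → IsIso εZ → εZ ≫ redSubι G₁ Γ₁ hΓ₁ = redSubι G Z hZ ≫ ϱ →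
        (∀ x : redSub G Z hZ, IsRegularLocalRing (G.presheaf.stalk (redSubι G Z hZ x))) → DirStepUnobs G E hE Z hZ →
        -- the downstairs direction of `Γ₁` (DIRDICT (a) `exists_direction_of_section`, output block verbatim)
        vanishingIdeal (⟨Z₀, hZ₀⟩ : Closeds G₀) * vanishingIdeal (⟨Z₀, hZ₀⟩ : Closeds G₀) ≤ 𝒟' → 𝒟' ≤ vanishingIdeal (⟨Z₀, hZ₀⟩ : Closeds G₀) →
        (∀ z ∈ Z₀, ∃ c : Fin 2 → G₀.presheaf.stalk z,
          Ideal.span (Set.range c) = stalkIdeal (vanishingIdeal (⟨Z₀, hZ₀⟩ : Closeds G₀)) z ∧ IsQuasiRegular c ∧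
          stalkIdeal 𝒟' z = Ideal.span {c 0} ⊔ Ideal.span {c 1 * c 1}) →
        controlledTransform υ₁ (vanishingIdeal (⟨Z₀, hZ₀⟩ : Closeds G₀)) 𝒟' 1 = vanishingIdeal (⟨Γ₁, hΓ₁⟩ : Closeds G₁) →
        ∃ 𝒟 : X₀.IdealSheafData, I * I ≤ 𝒟 ∧ 𝒟 ≤ I ∧
          (∀ x ∈ I.support, ∃ c : Fin 2 → X₀.presheaf.stalk x, Ideal.span (Set.range c) = stalkIdeal I x ∧ IsQuasiRegular c ∧
            stalkIdeal 𝒟 x = Ideal.span {c 0} ⊔ Ideal.span {c 1 * c 1}) ∧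
          𝒟.comap j₀ = 𝒟')
    -- (N3) the transported shadow next to the NEW surface, off the shadow
    (hShadow : ∀ {F₉ : Scheme.{0}} (Z₉ : Set F₉) (hZ₉ : IsClosed Z₉) {F₁₀ : Scheme.{0}} (υ' : F₁₀ ⟶ F₉)
        (G G' : Scheme.{0}) (γ : G ⟶ F₁₀) (T E K : Set G) (hE : IsClosed E) (Z : Set G) (hZ : IsClosed Z) (υ₂ : G' ⟶ G),
        DirStepSec F₉ F₁₀ υ' Z₉ hZ₉ G γ Z hZ → IsBlowup υ₂ (vanishingIdeal ⟨Z, hZ⟩) →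
        ∀ (X : Scheme.{0}) (σ : X ⟶ P) (S : Set X) (jG : G ⟶ X) (tG : G ⟶ Spec (.of k)) (𝓔 𝒦 𝒦₁ : X.IdealSheafData)
        (X₂ : Scheme.{0}) (τ : X₂ ⟶ X) (j₂ : G' ⟶ X₂) (t₂ : G' ⟶ Spec (.of k)),
        Ch X σ S → IsIntegral X → IsLocallyNoetherian X → Scheme.IsRegular X → IsDominant (σ ≫ q) →
        IsPullback jG tG (σ ≫ q) (Spec.map (CommRingCat.ofHom θ)) → jG '' T = S →
        𝓔.comap jG = vanishingIdeal ⟨E, hE⟩ → (∀ z : X, (stalkIdeal 𝓔 z).IsPrincipal) → Scheme.IsRegular 𝓔.subscheme →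
        (∀ z : X, (stalkIdeal 𝒦 z).IsPrincipal) → 𝒦.comap jG = vanishingIdeal (⟨closure K, isClosed_closure⟩ : Closeds G) →
        Flat ((𝓔 ⊔ 𝒦).subschemeι ≫ σ ≫ q) → IsEffectiveCartier (𝓔.comap 𝒦.subschemeι) → IsEffectiveCartier (𝒦.comap 𝓔.subschemeι) →
        (𝓔 ⊔ 𝒦₁).comap jG = vanishingIdeal ⟨Z, hZ⟩ → Flat ((𝓔 ⊔ 𝒦₁).subschemeι ≫ σ ≫ q) → Scheme.IsRegular (𝓔 ⊔ 𝒦₁).subscheme →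
        IsEffectiveCartier (𝒦₁.comap 𝓔.subschemeι) →
        IsBlowup τ (𝓔 ⊔ 𝒦₁) → IsPullback j₂ t₂ ((τ ≫ σ) ≫ q) (Spec.map (CommRingCat.ofHom θ)) → j₂ ≫ τ = υ₂ ≫ jG →
        IsClosed K → K ⊆ closure (K \ E) → K ≠ Set.univ → closure (Z \ closure K) = Z →
        (strictTransformIdeal τ (𝓔 ⊔ 𝒦₁) 𝒦).comap j₂ =
            vanishingIdeal (⟨closure (closure (υ₂ ⁻¹' (K \ Z))), isClosed_closure⟩ : Closeds G') ∧
          Flat ((((𝓔 ⊔ 𝒦₁).comap τ) ⊔ strictTransformIdeal τ (𝓔 ⊔ 𝒦₁) 𝒦).subschemeι ≫ (τ ≫ σ) ≫ q) ∧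
          (∀ (hE' : IsClosed (υ₂ ⁻¹' Z)) (y : G'),
            j₂ y ∈ ((((𝓔 ⊔ 𝒦₁).comap τ) ⊔ strictTransformIdeal τ (𝓔 ⊔ 𝒦₁) 𝒦).support : Set X₂) →
            stalkIdeal (vanishingIdeal (⟨υ₂ ⁻¹' Z, hE'⟩ : Closeds G') ⊔
              vanishingIdeal (⟨closure (closure (υ₂ ⁻¹' (K \ Z))), isClosed_closure⟩ : Closeds G')) y =
            stalkIdeal (vanishingIdeal (⟨υ₂ ⁻¹' Z ∩ closure (closure (υ₂ ⁻¹' (K \ Z))), hE'.inter isClosed_closure⟩ : Closeds G')) y →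
            IsRegularLocalRing (X₂.presheaf.stalk (j₂ y) ⧸
              stalkIdeal (((𝓔 ⊔ 𝒦₁).comap τ) ⊔ strictTransformIdeal τ (𝓔 ⊔ 𝒦₁) 𝒦) (j₂ y))) ∧
          IsEffectiveCartier (((𝓔 ⊔ 𝒦₁).comap τ).comap (strictTransformIdeal τ (𝓔 ⊔ 𝒦₁) 𝒦).subschemeι) ∧
          IsEffectiveCartier ((strictTransformIdeal τ (𝓔 ⊔ 𝒦₁) 𝒦).comap ((𝓔 ⊔ 𝒦₁).comap τ).subschemeι))
    -- (N3′) the transported shadow next to the OLD surface, off the shadow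
    (hShadowOld : ∀ {F₉ : Scheme.{0}} (Z₉ : Set F₉) (hZ₉ : IsClosed Z₉) {F₁₀ : Scheme.{0}} (υ' : F₁₀ ⟶ F₉)
        (G G' : Scheme.{0}) (γ : G ⟶ F₁₀) (T E K : Set G) (hE : IsClosed E) (Z : Set G) (hZ : IsClosed Z) (υ₂ : G' ⟶ G),
        DirStepSec F₉ F₁₀ υ' Z₉ hZ₉ G γ Z hZ → IsBlowup υ₂ (vanishingIdeal ⟨Z, hZ⟩) →
        ∀ (X : Scheme.{0}) (σ : X ⟶ P) (S : Set X) (jG : G ⟶ X) (tG : G ⟶ Spec (.of k)) (𝓔 𝒦 𝒦₁ : X.IdealSheafData)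
        (X₂ : Scheme.{0}) (τ : X₂ ⟶ X) (j₂ : G' ⟶ X₂) (t₂ : G' ⟶ Spec (.of k)),
        Ch X σ S → IsIntegral X → IsLocallyNoetherian X → Scheme.IsRegular X → IsDominant (σ ≫ q) →
        IsPullback jG tG (σ ≫ q) (Spec.map (CommRingCat.ofHom θ)) → jG '' T = S →
        𝓔.comap jG = vanishingIdeal ⟨E, hE⟩ → (∀ z : X, (stalkIdeal 𝓔 z).IsPrincipal) → Scheme.IsRegular 𝓔.subscheme →
        (∀ z : X, (stalkIdeal 𝒦 z).IsPrincipal) → 𝒦.comap jG = vanishingIdeal (⟨closure K, isClosed_closure⟩ : Closeds G) →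
        Flat ((𝓔 ⊔ 𝒦).subschemeι ≫ σ ≫ q) → IsEffectiveCartier (𝓔.comap 𝒦.subschemeι) → IsEffectiveCartier (𝒦.comap 𝓔.subschemeι) →
        (𝓔 ⊔ 𝒦₁).comap jG = vanishingIdeal ⟨Z, hZ⟩ → Flat ((𝓔 ⊔ 𝒦₁).subschemeι ≫ σ ≫ q) → Scheme.IsRegular (𝓔 ⊔ 𝒦₁).subscheme →
        IsEffectiveCartier (𝒦₁.comap 𝓔.subschemeι) →
        IsBlowup τ (𝓔 ⊔ 𝒦₁) → IsPullback j₂ t₂ ((τ ≫ σ) ≫ q) (Spec.map (CommRingCat.ofHom θ)) → j₂ ≫ τ = υ₂ ≫ jG →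
        IsClosed K → K ⊆ closure (K \ E) → K ≠ Set.univ → closure (Z \ closure K) = Z →
        (strictTransformIdeal τ (𝓔 ⊔ 𝒦₁) 𝒦).comap j₂ =
            vanishingIdeal (⟨closure (closure (υ₂ ⁻¹' (K \ Z))), isClosed_closure⟩ : Closeds G') ∧
          Flat ((strictTransformIdeal τ (𝓔 ⊔ 𝒦₁) 𝓔 ⊔ strictTransformIdeal τ (𝓔 ⊔ 𝒦₁) 𝒦).subschemeι ≫ (τ ≫ σ) ≫ q) ∧
          (∀ (hE' : IsClosed (closure (υ₂ ⁻¹' (E \ Z)))) (y : G'),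
            j₂ y ∈ ((strictTransformIdeal τ (𝓔 ⊔ 𝒦₁) 𝓔 ⊔ strictTransformIdeal τ (𝓔 ⊔ 𝒦₁) 𝒦).support : Set X₂) →
            stalkIdeal (vanishingIdeal (⟨closure (υ₂ ⁻¹' (E \ Z)), hE'⟩ : Closeds G') ⊔
              vanishingIdeal (⟨closure (closure (υ₂ ⁻¹' (K \ Z))), isClosed_closure⟩ : Closeds G')) y =
            stalkIdeal (vanishingIdeal (⟨closure (υ₂ ⁻¹' (E \ Z)) ∩ closure (closure (υ₂ ⁻¹' (K \ Z))), hE'.inter isClosed_closure⟩ :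
              Closeds G')) y →
            IsRegularLocalRing (X₂.presheaf.stalk (j₂ y) ⧸
              stalkIdeal (strictTransformIdeal τ (𝓔 ⊔ 𝒦₁) 𝓔 ⊔ strictTransformIdeal τ (𝓔 ⊔ 𝒦₁) 𝒦) (j₂ y))) ∧
          IsEffectiveCartier ((strictTransformIdeal τ (𝓔 ⊔ 𝒦₁) 𝓔).comap (strictTransformIdeal τ (𝓔 ⊔ 𝒦₁) 𝒦).subschemeι) ∧
          IsEffectiveCartier ((strictTransformIdeal τ (𝓔 ⊔ 𝒦₁) 𝒦).comap (strictTransformIdeal τ (𝓔 ⊔ 𝒦₁) 𝓔).subschemeι))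
    -- S2 the assembly's own stand-in (ruled-surface datum born at a CONE round), for the cone-witnessed sub-case
    (hRootRound : ∀ {F₉ : Scheme.{0}} (Z₉ : Set F₉) (hZ₉ : IsClosed Z₉) {F₁₀ : Scheme.{0}} (υ' : F₁₀ ⟶ F₉)
        (G G' : Scheme.{0}) (γ : G ⟶ F₁₀) (T : Set G) (Z : Set G) (hZ : IsClosed Z) (υ₂ : G' ⟶ G)
        (X : Scheme.{0}) (σ : X ⟶ P) (S : Set X) (jG : G ⟶ X) (tG : G ⟶ Spec (.of k)) (𝓔 𝒦 : X.IdealSheafData)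
        (X'' : Scheme.{0}) (τ : X'' ⟶ X) (j₂ : G' ⟶ X'') (t₂ : G' ⟶ Spec (.of k)),
        Ch X σ S → IsIntegral X → IsLocallyNoetherian X → Scheme.IsRegular X → IsDominant (σ ≫ q) →
        IsPullback jG tG (σ ≫ q) (Spec.map (CommRingCat.ofHom θ)) → jG '' T = S →
        (𝓔 ⊔ 𝒦).comap jG = vanishingIdeal ⟨Z, hZ⟩ → Flat ((𝓔 ⊔ 𝒦).subschemeι ≫ σ ≫ q) → Scheme.IsRegular (𝓔 ⊔ 𝒦).subscheme →
        Scheme.IsRegular 𝓔.subscheme → IsBlowup τ (𝓔 ⊔ 𝒦) → IsPullback j₂ t₂ ((τ ≫ σ) ≫ q) (Spec.map (CommRingCat.ofHom θ)) →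
        j₂ ≫ τ = υ₂ ≫ jG →
        DirLift.Ruled O k θ P q Y F₉ Z₉ hZ₉ F₁₀ υ' G' (υ₂ ≫ γ) (υ₂ ⁻¹' Z) X'' (τ ≫ σ) j₂ ((𝓔 ⊔ 𝒦).comap τ)) :
    -- ======== the `hCech` binder of `hsub_reachTower_three_of`, VERBATIM ========
    ∀ {F₉ : Scheme.{0}} (Z₉ : Set F₉) (hZ₉ : IsClosed Z₉) {F₁₀ : Scheme.{0}} (υ' : F₁₀ ⟶ F₉)
        (G G' : Scheme.{0}) (γ : G ⟶ F₁₀) (T E K : Set G) (hE : IsClosed E) (Z : Set G) (hZ : IsClosed Z) (υ₂ : G' ⟶ G) (K' : Set G'),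
        (Tower.Inv₂ O k θ P q Y Ch (DirLift.Ruled O k θ P q Y) F₉ Z₉ hZ₉ F₁₀ υ' G γ T E K ∧ IsClosed K ∧ K ⊆ closure (K \ E) ∧ K ≠ Set.univ) →
        Z ⊆ E ∩ T → Z.Nonempty → TowerFull F₉ F₁₀ υ' Z₉ hZ₉ G γ Z hZ →
        (DirStepSec F₉ F₁₀ υ' Z₉ hZ₉ G γ Z hZ ∧ RationalCarrier (redSub F₉ Z₉ hZ₉) ∧
          (∀ x : redSub G Z hZ, IsRegularLocalRing (G.presheaf.stalk (redSubι G Z hZ x))) ∧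
          (∀ (i : redSub G Z hZ ⟶ redSub G E hE), i ≫ redSubι G E hE = redSubι G Z hZ →
            ∀ x : redSub G Z hZ, IsRegularLocalRing ((redSub G E hE).presheaf.stalk (i x))) ∧ DirStepUnobs G E hE Z hZ) →
        IsBlowup υ₂ (vanishingIdeal (⟨Z, hZ⟩ : Closeds G)) →
        (K' = ∅ ∨ ((ConeWitness G E hE K Z hZ ∨ closure (Z \ closure K) = Z) ∧ K' = closure (υ₂ ⁻¹' (K \ Z)))) →
        (Tower.Inv₂ O k θ P q Y Ch (DirLift.Ruled O k θ P q Y) F₉ Z₉ hZ₉ F₁₀ υ' G' (υ₂ ≫ γ) (closure (υ₂ ⁻¹' (T \ Z))) (υ₂ ⁻¹' Z) K' ∧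
            IsClosed K' ∧ K' ⊆ closure (K' \ υ₂ ⁻¹' Z) ∧ K' ≠ Set.univ) ∧
          (Tower.Inv₂ O k θ P q Y Ch (DirLift.Ruled O k θ P q Y) F₉ Z₉ hZ₉ F₁₀ υ' G' (υ₂ ≫ γ) (closure (υ₂ ⁻¹' (T \ Z))) (closure (υ₂ ⁻¹' (E \ Z))) K' ∧
            IsClosed K' ∧ K' ⊆ closure (K' \ closure (υ₂ ⁻¹' (E \ Z))) ∧ K' ≠ Set.univ) :=
  Tower.hCech_of_root O k θ hθ P q hqprop Y hYirr hYcl hPnoeth hPreg Ch hChain hStep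
    (Tower.hRootCentre_of_lift O k θ hθ P q Y hLift) hShadow hShadowOld hRootRound


set_option maxHeartbeats 1600000 in -- long binder texts; four case dispatches
/-- **S6 `hCech` closed modulo (L) + (N3) + (N3′), v6 CURRENCY** (res-D-pv-018's `hsub_reachTower_four_of`: S2 replaced by `hFrameAll` + `hTj`; the
cone-witnessed sub-case of the `K′` menu goes through res-L1-w45b-stub-4's `Tower.inv₂_coneRound_new_sec` (p570221) and res-D-pv-029's `_old` with
stub-2's S4/S5). [OURS · L1 W4.5b] toward `stub_elnat_coneTowerPointResolution` (stmt-ResolutionOfSingularities-20148 / -20038); NOT a statement of the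
manuscript. -/
theorem Tower.hCech_of_lift_sec (O : Type) [CommRing O] [IsDomain O] [IsDiscreteValuationRing O] (k : Type) [Field k]
    (θ : O →+* k) (hθ : Function.Surjective θ)
    (P : Scheme.{0}) (q : P ⟶ Spec (.of O)) (hqprop : IsProper q) (Y : Set P) (hYirr : IsIrreducible Y) (hYcl : IsClosed Y)
    (hPnoeth : IsLocallyNoetherian P) (hPreg : Scheme.IsRegular P)
    (Ch : ∀ X' : Scheme.{0}, (X' ⟶ P) → Set X' → Prop)
    (hChain : ∀ (X' : Scheme.{0}) (σ : X' ⟶ P) (S : Set X'), Ch X' σ S → Chain P Y X' σ S)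
    (hStep : ∀ (X' X'' : Scheme.{0}) (σ' : X' ⟶ P) (S' : Set X') (C : X'.IdealSheafData) (τ : X'' ⟶ X'),
      Ch X' σ' S' → IsBlowup τ C → Scheme.IsRegular C.subscheme → Flat (C.subschemeι ≫ σ' ≫ q) →
      σ' '' (C.support : Set X') ⊆ {x : P | ¬ IsGenericPoint x Y} →
      (C.support : Set X') ∩ (σ' ≫ q) ⁻¹' {IsLocalRing.closedPoint O} ⊆ S' →
      Ch X'' (τ ≫ σ') (closure (τ ⁻¹' (S' \ (C.support : Set X')))))
    -- (L) the direction lift at the root (T-DIRLIFT-UP's conclusion, frames at every point of `V(I)`)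
    (hLift : ∀ {F₉ : Scheme.{0}} (Z₉ : Set F₉) (hZ₉ : IsClosed Z₉)
        (G : Scheme.{0}) (E : Set G) (hE : IsClosed E) (Z : Set G) (hZ : IsClosed Z)
        (X₀ : Scheme.{0}) (σ₀ : X₀ ⟶ P) (I : X₀.IdealSheafData) (G₀ : Scheme.{0}) (j₀ : G₀ ⟶ X₀) (t₀ : G₀ ⟶ Spec (.of k))
        (Z₀ : Set G₀) (hZ₀ : IsClosed Z₀) (G₁ : Scheme.{0}) (υ₁ : G₁ ⟶ G₀) (ϱ : G ⟶ G₁)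
        (E₁ : Set G₁) (hE₁ : IsClosed E₁) (Γ₁ : Set G₁) (hΓ₁ : IsClosed Γ₁)
        (ε : redSub G E hE ⟶ redSub G₁ E₁ hE₁) (εZ : redSub G Z hZ ⟶ redSub G₁ Γ₁ hΓ₁) (𝒟' : G₀.IdealSheafData),
        -- the root (R1)–(R4)
        IsIntegral X₀ → IsLocallyNoetherian X₀ → Scheme.IsRegular X₀ →
        IsPullback j₀ t₀ (σ₀ ≫ q) (Spec.map (CommRingCat.ofHom θ)) →
        Scheme.IsRegular I.subscheme → Flat (I.subschemeι ≫ σ₀ ≫ q) →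
        (∀ x ∈ I.support, ∃ c : Fin 2 → X₀.presheaf.stalk x, Ideal.span (Set.range c) = stalkIdeal I x ∧ IsQuasiRegular c) →
        RationalCarrier (redSub F₉ Z₉ hZ₉) →
        (RationalCarrier (redSub F₉ Z₉ hZ₉) → ∃ e₁ : I.subscheme ≅ ProjCech.PP O 1, e₁.hom ≫ ProjCech.toSpec O 1 = I.subschemeι ≫ σ₀ ≫ q) →
        I.comap j₀ = vanishingIdeal ⟨Z₀, hZ₀⟩ →
        -- the downstairs round at the root: blow-up of the carrier trace, the pushed section `Γ₁ ⊆ E₁ = υ₁⁻¹Z₀`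
        IsBlowup υ₁ (vanishingIdeal (⟨Z₀, hZ₀⟩ : Closeds G₀)) → E₁ = υ₁ ⁻¹' Z₀ → Γ₁ ⊆ E₁ → Γ₁ = ϱ '' Z → Z ⊆ E →
        (∃ δ₁ : redSub G₁ Γ₁ hΓ₁ ⟶ redSub G₀ Z₀ hZ₀, δ₁ ≫ redSubι G₀ Z₀ hZ₀ = redSubι G₁ Γ₁ hΓ₁ ≫ υ₁ ∧ IsIso δ₁) →
        (∀ (i₁ : redSub G₁ Γ₁ hΓ₁ ⟶ redSub G₁ E₁ hE₁), i₁ ≫ redSubι G₁ E₁ hE₁ = redSubι G₁ Γ₁ hΓ₁ →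
          ∀ x₁ : redSub G₁ Γ₁ hΓ₁, IsRegularLocalRing ((redSub G₁ E₁ hE₁).presheaf.stalk (i₁ x₁))) →
        -- the stage's unobstructedness datum, handed with the special-fibre isomorphisms (exceptional pair abstracted)
        IsIso ε → ε ≫ redSubι G₁ E₁ hE₁ = redSubι G E hE ≫ ϱ → IsIso εZ → εZ ≫ redSubι G₁ Γ₁ hΓ₁ = redSubι G Z hZ ≫ ϱ →
        (∀ x : redSub G Z hZ, IsRegularLocalRing (G.presheaf.stalk (redSubι G Z hZ x))) → DirStepUnobs G E hE Z hZ →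
        -- the downstairs direction of `Γ₁` (DIRDICT (a) `exists_direction_of_section`, output block verbatim)
        vanishingIdeal (⟨Z₀, hZ₀⟩ : Closeds G₀) * vanishingIdeal (⟨Z₀, hZ₀⟩ : Closeds G₀) ≤ 𝒟' → 𝒟' ≤ vanishingIdeal (⟨Z₀, hZ₀⟩ : Closeds G₀) →
        (∀ z ∈ Z₀, ∃ c : Fin 2 → G₀.presheaf.stalk z,
          Ideal.span (Set.range c) = stalkIdeal (vanishingIdeal (⟨Z₀, hZ₀⟩ : Closeds G₀)) z ∧ IsQuasiRegular c ∧
          stalkIdeal 𝒟' z = Ideal.span {c 0} ⊔ Ideal.span {c 1 * c 1}) →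
        controlledTransform υ₁ (vanishingIdeal (⟨Z₀, hZ₀⟩ : Closeds G₀)) 𝒟' 1 = vanishingIdeal (⟨Γ₁, hΓ₁⟩ : Closeds G₁) →
        ∃ 𝒟 : X₀.IdealSheafData, I * I ≤ 𝒟 ∧ 𝒟 ≤ I ∧
          (∀ x ∈ I.support, ∃ c : Fin 2 → X₀.presheaf.stalk x, Ideal.span (Set.range c) = stalkIdeal I x ∧ IsQuasiRegular c ∧
            stalkIdeal 𝒟 x = Ideal.span {c 0} ⊔ Ideal.span {c 1 * c 1}) ∧
          𝒟.comap j₀ = 𝒟')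
    -- (N3) the transported shadow next to the NEW surface, off the shadow
    (hShadow : ∀ {F₉ : Scheme.{0}} (Z₉ : Set F₉) (hZ₉ : IsClosed Z₉) {F₁₀ : Scheme.{0}} (υ' : F₁₀ ⟶ F₉)
        (G G' : Scheme.{0}) (γ : G ⟶ F₁₀) (T E K : Set G) (hE : IsClosed E) (Z : Set G) (hZ : IsClosed Z) (υ₂ : G' ⟶ G),
        DirStepSec F₉ F₁₀ υ' Z₉ hZ₉ G γ Z hZ → IsBlowup υ₂ (vanishingIdeal ⟨Z, hZ⟩) →
        ∀ (X : Scheme.{0}) (σ : X ⟶ P) (S : Set X) (jG : G ⟶ X) (tG : G ⟶ Spec (.of k)) (𝓔 𝒦 𝒦₁ : X.IdealSheafData)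
        (X₂ : Scheme.{0}) (τ : X₂ ⟶ X) (j₂ : G' ⟶ X₂) (t₂ : G' ⟶ Spec (.of k)),
        Ch X σ S → IsIntegral X → IsLocallyNoetherian X → Scheme.IsRegular X → IsDominant (σ ≫ q) →
        IsPullback jG tG (σ ≫ q) (Spec.map (CommRingCat.ofHom θ)) → jG '' T = S →
        𝓔.comap jG = vanishingIdeal ⟨E, hE⟩ → (∀ z : X, (stalkIdeal 𝓔 z).IsPrincipal) → Scheme.IsRegular 𝓔.subscheme →
        (∀ z : X, (stalkIdeal 𝒦 z).IsPrincipal) → 𝒦.comap jG = vanishingIdeal (⟨closure K, isClosed_closure⟩ : Closeds G) →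
        Flat ((𝓔 ⊔ 𝒦).subschemeι ≫ σ ≫ q) → IsEffectiveCartier (𝓔.comap 𝒦.subschemeι) → IsEffectiveCartier (𝒦.comap 𝓔.subschemeι) →
        (𝓔 ⊔ 𝒦₁).comap jG = vanishingIdeal ⟨Z, hZ⟩ → Flat ((𝓔 ⊔ 𝒦₁).subschemeι ≫ σ ≫ q) → Scheme.IsRegular (𝓔 ⊔ 𝒦₁).subscheme →
        IsEffectiveCartier (𝒦₁.comap 𝓔.subschemeι) →
        IsBlowup τ (𝓔 ⊔ 𝒦₁) → IsPullback j₂ t₂ ((τ ≫ σ) ≫ q) (Spec.map (CommRingCat.ofHom θ)) → j₂ ≫ τ = υ₂ ≫ jG →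
        IsClosed K → K ⊆ closure (K \ E) → K ≠ Set.univ → closure (Z \ closure K) = Z →
        (strictTransformIdeal τ (𝓔 ⊔ 𝒦₁) 𝒦).comap j₂ =
            vanishingIdeal (⟨closure (closure (υ₂ ⁻¹' (K \ Z))), isClosed_closure⟩ : Closeds G') ∧
          Flat ((((𝓔 ⊔ 𝒦₁).comap τ) ⊔ strictTransformIdeal τ (𝓔 ⊔ 𝒦₁) 𝒦).subschemeι ≫ (τ ≫ σ) ≫ q) ∧
          (∀ (hE' : IsClosed (υ₂ ⁻¹' Z)) (y : G'),
            j₂ y ∈ ((((𝓔 ⊔ 𝒦₁).comap τ) ⊔ strictTransformIdeal τ (𝓔 ⊔ 𝒦₁) 𝒦).support : Set X₂) →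
            stalkIdeal (vanishingIdeal (⟨υ₂ ⁻¹' Z, hE'⟩ : Closeds G') ⊔
              vanishingIdeal (⟨closure (closure (υ₂ ⁻¹' (K \ Z))), isClosed_closure⟩ : Closeds G')) y =
            stalkIdeal (vanishingIdeal (⟨υ₂ ⁻¹' Z ∩ closure (closure (υ₂ ⁻¹' (K \ Z))), hE'.inter isClosed_closure⟩ : Closeds G')) y →
            IsRegularLocalRing (X₂.presheaf.stalk (j₂ y) ⧸
              stalkIdeal (((𝓔 ⊔ 𝒦₁).comap τ) ⊔ strictTransformIdeal τ (𝓔 ⊔ 𝒦₁) 𝒦) (j₂ y))) ∧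
          IsEffectiveCartier (((𝓔 ⊔ 𝒦₁).comap τ).comap (strictTransformIdeal τ (𝓔 ⊔ 𝒦₁) 𝒦).subschemeι) ∧
          IsEffectiveCartier ((strictTransformIdeal τ (𝓔 ⊔ 𝒦₁) 𝒦).comap ((𝓔 ⊔ 𝒦₁).comap τ).subschemeι))
    -- (N3′) the transported shadow next to the OLD surface, off the shadow
    (hShadowOld : ∀ {F₉ : Scheme.{0}} (Z₉ : Set F₉) (hZ₉ : IsClosed Z₉) {F₁₀ : Scheme.{0}} (υ' : F₁₀ ⟶ F₉)
        (G G' : Scheme.{0}) (γ : G ⟶ F₁₀) (T E K : Set G) (hE : IsClosed E) (Z : Set G) (hZ : IsClosed Z) (υ₂ : G' ⟶ G),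
        DirStepSec F₉ F₁₀ υ' Z₉ hZ₉ G γ Z hZ → IsBlowup υ₂ (vanishingIdeal ⟨Z, hZ⟩) →
        ∀ (X : Scheme.{0}) (σ : X ⟶ P) (S : Set X) (jG : G ⟶ X) (tG : G ⟶ Spec (.of k)) (𝓔 𝒦 𝒦₁ : X.IdealSheafData)
        (X₂ : Scheme.{0}) (τ : X₂ ⟶ X) (j₂ : G' ⟶ X₂) (t₂ : G' ⟶ Spec (.of k)),
        Ch X σ S → IsIntegral X → IsLocallyNoetherian X → Scheme.IsRegular X → IsDominant (σ ≫ q) →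
        IsPullback jG tG (σ ≫ q) (Spec.map (CommRingCat.ofHom θ)) → jG '' T = S →
        𝓔.comap jG = vanishingIdeal ⟨E, hE⟩ → (∀ z : X, (stalkIdeal 𝓔 z).IsPrincipal) → Scheme.IsRegular 𝓔.subscheme →
        (∀ z : X, (stalkIdeal 𝒦 z).IsPrincipal) → 𝒦.comap jG = vanishingIdeal (⟨closure K, isClosed_closure⟩ : Closeds G) →
        Flat ((𝓔 ⊔ 𝒦).subschemeι ≫ σ ≫ q) → IsEffectiveCartier (𝓔.comap 𝒦.subschemeι) → IsEffectiveCartier (𝒦.comap 𝓔.subschemeι) →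
        (𝓔 ⊔ 𝒦₁).comap jG = vanishingIdeal ⟨Z, hZ⟩ → Flat ((𝓔 ⊔ 𝒦₁).subschemeι ≫ σ ≫ q) → Scheme.IsRegular (𝓔 ⊔ 𝒦₁).subscheme →
        IsEffectiveCartier (𝒦₁.comap 𝓔.subschemeι) →
        IsBlowup τ (𝓔 ⊔ 𝒦₁) → IsPullback j₂ t₂ ((τ ≫ σ) ≫ q) (Spec.map (CommRingCat.ofHom θ)) → j₂ ≫ τ = υ₂ ≫ jG →
        IsClosed K → K ⊆ closure (K \ E) → K ≠ Set.univ → closure (Z \ closure K) = Z →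
        (strictTransformIdeal τ (𝓔 ⊔ 𝒦₁) 𝒦).comap j₂ =
            vanishingIdeal (⟨closure (closure (υ₂ ⁻¹' (K \ Z))), isClosed_closure⟩ : Closeds G') ∧
          Flat ((strictTransformIdeal τ (𝓔 ⊔ 𝒦₁) 𝓔 ⊔ strictTransformIdeal τ (𝓔 ⊔ 𝒦₁) 𝒦).subschemeι ≫ (τ ≫ σ) ≫ q) ∧
          (∀ (hE' : IsClosed (closure (υ₂ ⁻¹' (E \ Z)))) (y : G'),
            j₂ y ∈ ((strictTransformIdeal τ (𝓔 ⊔ 𝒦₁) 𝓔 ⊔ strictTransformIdeal τ (𝓔 ⊔ 𝒦₁) 𝒦).support : Set X₂) →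
            stalkIdeal (vanishingIdeal (⟨closure (υ₂ ⁻¹' (E \ Z)), hE'⟩ : Closeds G') ⊔
              vanishingIdeal (⟨closure (closure (υ₂ ⁻¹' (K \ Z))), isClosed_closure⟩ : Closeds G')) y =
            stalkIdeal (vanishingIdeal (⟨closure (υ₂ ⁻¹' (E \ Z)) ∩ closure (closure (υ₂ ⁻¹' (K \ Z))), hE'.inter isClosed_closure⟩ :
              Closeds G')) y →
            IsRegularLocalRing (X₂.presheaf.stalk (j₂ y) ⧸
              stalkIdeal (strictTransformIdeal τ (𝓔 ⊔ 𝒦₁) 𝓔 ⊔ strictTransformIdeal τ (𝓔 ⊔ 𝒦₁) 𝒦) (j₂ y))) ∧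
          IsEffectiveCartier ((strictTransformIdeal τ (𝓔 ⊔ 𝒦₁) 𝓔).comap (strictTransformIdeal τ (𝓔 ⊔ 𝒦₁) 𝒦).subschemeι) ∧
          IsEffectiveCartier ((strictTransformIdeal τ (𝓔 ⊔ 𝒦₁) 𝒦).comap (strictTransformIdeal τ (𝓔 ⊔ 𝒦₁) 𝓔).subschemeι))
    -- v6 currency (res-D-pv-018 `hsub_reachTower_four_of`): the cone-witnessed sub-case through res-L1-w45b-stub-4's `Tower.inv₂_coneRound_new_sec`
    (hYsp : Y ⊆ q ⁻¹' {IsLocalRing.closedPoint O})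
    (hFrameAll : ∀ {G : Scheme.{0}} (T : Set G) (Z : Set G) (hZ : IsClosed Z)
        (X : Scheme.{0}) (σ : X ⟶ P) (S : Set X) (jG : G ⟶ X) (tG : G ⟶ Spec (.of k)) (𝒞 : X.IdealSheafData),
      Ch X σ S → IsIntegral X → IsLocallyNoetherian X → Scheme.IsRegular X → IsDominant (σ ≫ q) →
      IsPullback jG tG (σ ≫ q) (Spec.map (CommRingCat.ofHom θ)) → jG '' T = S →
      𝒞.comap jG = vanishingIdeal ⟨Z, hZ⟩ → Flat (𝒞.subschemeι ≫ σ ≫ q) → Scheme.IsRegular 𝒞.subscheme →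
      ∀ x ∈ 𝒞.support, ∃ c : Fin 2 → X.presheaf.stalk x, Ideal.span (Set.range c) = stalkIdeal 𝒞 x ∧ IsQuasiRegular c)
    (hTj : RationalCarrierLift O k θ P q) :
    -- ======== the `hCech` binder of `hsub_reachTower_three_of`, VERBATIM ========
    ∀ {F₉ : Scheme.{0}} (Z₉ : Set F₉) (hZ₉ : IsClosed Z₉) {F₁₀ : Scheme.{0}} (υ' : F₁₀ ⟶ F₉)
        (G G' : Scheme.{0}) (γ : G ⟶ F₁₀) (T E K : Set G) (hE : IsClosed E) (Z : Set G) (hZ : IsClosed Z) (υ₂ : G' ⟶ G) (K' : Set G'),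
        (Tower.Inv₂ O k θ P q Y Ch (DirLift.Ruled O k θ P q Y) F₉ Z₉ hZ₉ F₁₀ υ' G γ T E K ∧ IsClosed K ∧ K ⊆ closure (K \ E) ∧ K ≠ Set.univ) →
        Z ⊆ E ∩ T → Z.Nonempty → TowerFull F₉ F₁₀ υ' Z₉ hZ₉ G γ Z hZ →
        (DirStepSec F₉ F₁₀ υ' Z₉ hZ₉ G γ Z hZ ∧ RationalCarrier (redSub F₉ Z₉ hZ₉) ∧
          (∀ x : redSub G Z hZ, IsRegularLocalRing (G.presheaf.stalk (redSubι G Z hZ x))) ∧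
          (∀ (i : redSub G Z hZ ⟶ redSub G E hE), i ≫ redSubι G E hE = redSubι G Z hZ →
            ∀ x : redSub G Z hZ, IsRegularLocalRing ((redSub G E hE).presheaf.stalk (i x))) ∧ DirStepUnobs G E hE Z hZ) →
        IsBlowup υ₂ (vanishingIdeal (⟨Z, hZ⟩ : Closeds G)) →
        (K' = ∅ ∨ ((ConeWitness G E hE K Z hZ ∨ closure (Z \ closure K) = Z) ∧ K' = closure (υ₂ ⁻¹' (K \ Z)))) →
        (Tower.Inv₂ O k θ P q Y Ch (DirLift.Ruled O k θ P q Y) F₉ Z₉ hZ₉ F₁₀ υ' G' (υ₂ ≫ γ) (closure (υ₂ ⁻¹' (T \ Z))) (υ₂ ⁻¹' Z) K' ∧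
            IsClosed K' ∧ K' ⊆ closure (K' \ υ₂ ⁻¹' Z) ∧ K' ≠ Set.univ) ∧
          (Tower.Inv₂ O k θ P q Y Ch (DirLift.Ruled O k θ P q Y) F₉ Z₉ hZ₉ F₁₀ υ' G' (υ₂ ≫ γ) (closure (υ₂ ⁻¹' (T \ Z))) (closure (υ₂ ⁻¹' (E \ Z))) K' ∧
            IsClosed K' ∧ K' ⊆ closure (K' \ closure (υ₂ ⁻¹' (E \ Z))) ∧ K' ≠ Set.univ) := by
  intro F₉ Z₉ hZ₉ F₁₀ υ' G G' γ T E K hE Z hZ υ₂ K' hI hZET hZne hfull hwit hυ₂ hK'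
  haveI := hqprop
  obtain ⟨hinv, hKcl, hKE, hKne⟩ := hI
  obtain ⟨hsec, hrat, hGreg, hEreg, hunobs⟩ := hwit
  have hGint : IsIntegral G := hinv.2.2.1
  have hEcl : IsClosed E := hinv.2.2.2.2.2.1
  have hTE : ¬ T ⊆ E := hinv.2.2.2.2.2.2.1
  haveI := hGint
  have hZE : Z ⊆ E := fun z hz => (hZET hz).1
  have hTZ : ¬ T ⊆ Z := fun h => hTE (h.trans hZE)
  have hZsupp : ((vanishingIdeal (⟨Z, hZ⟩ : Closeds G) : G.IdealSheafData).support : Set G) = Z :=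
    Scheme.IdealSheafData.coe_support_vanishingIdeal _
  -- the two `Tower.Inv₂` conclusions, for the three admitted shapes of `K′`
  have hboth : Tower.Inv₂ O k θ P q Y Ch (DirLift.Ruled O k θ P q Y) F₉ Z₉ hZ₉ F₁₀ υ' G' (υ₂ ≫ γ) (closure (υ₂ ⁻¹' (T \ Z))) (υ₂ ⁻¹' Z) K' ∧
      Tower.Inv₂ O k θ P q Y Ch (DirLift.Ruled O k θ P q Y) F₉ Z₉ hZ₉ F₁₀ υ' G' (υ₂ ≫ γ) (closure (υ₂ ⁻¹' (T \ Z)))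
        (closure (υ₂ ⁻¹' (E \ Z))) K' := by
    -- the Čech centre at this stage, (N1) fed with the witness
    have hC := Tower.hCentre_of_root O k θ hθ P q Y Ch (Tower.hRootCentre_of_lift O k θ hθ P q Y hLift) Z₉ hZ₉ υ' G γ T E hE Z hZ
      hZET hZne hfull hTE hsec hrat hGreg hEreg hunobs
    have hS := hShadow Z₉ hZ₉ υ' G G' γ T E K hE Z hZ υ₂ hsec hυ₂
    have hSo := hShadowOld Z₉ hZ₉ υ' G G' γ T E K hE Z hZ υ₂ hsec hυ₂
    rcases hK' with hK0 | ⟨hcase, hKst⟩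
    · exact ⟨Tower.inv₂_cechRound_new₂ O k θ hθ P q Y hYirr hYcl hPnoeth hPreg Ch hChain hStep Z₉ hZ₉ υ' G G' γ T E K hE Z hZ υ₂ hinv hZET hfull
          hsec hυ₂ hKcl hKE hKne hC hS K' (Or.inl hK0),
        Tower.inv₂_cechRound_old₂ O k θ hθ P q Y hYirr hYcl hPnoeth hPreg Ch hChain hStep Z₉ hZ₉ υ' G G' γ T E K hE Z hZ υ₂ hinv hZET hfull
          hυ₂ hKcl hKE hKne hC hSo K' (Or.inl hK0)⟩
    · rcases hcase with hcone | hoff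
      · -- cone-witnessed as well: res-D-pv-029's cone-round bricks (stand-ins discharged by stub-2's S4/S5, S2 passed through)
        have hK'' : K' = ∅ ∨ K' = closure (υ₂ ⁻¹' (K \ Z)) := Or.inr hKst
        exact ⟨Tower.inv₂_coneRound_new_sec O k θ hθ P q Y hYsp hYirr hYcl hPnoeth hPreg Ch hChain hStep Z₉ hZ₉ υ' G G' γ
            T E K hE Z hZ υ₂ hinv hZET hZne hsec hcone hυ₂ hKcl hKE hKne (hFrameAll T Z hZ) hTj K' hK'',
          Tower.inv₂_coneRound_old O k θ hθ P q Y hYirr hYcl hPnoeth hPreg Ch hChain hStep (DirLift.Ruled O k θ P q Y) Z₉ hZ₉ υ' G G' γ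
            T E K hE Z hZ υ₂ hinv hZET hZne hfull hcone hυ₂ hKcl hKE
            (Tower.subset_closure_diff_of_inv₂ O k θ hθ P q Y Ch (DirLift.Ruled O k θ P q Y) Z₉ hZ₉ υ' G γ T E K hE Z hZ hinv hfull hZE hcone)
            (fun X σ jG 𝓔 𝒦 X'' τ j₂ t₂ _ _ hcomm _ he h => by
              obtain ⟨e, he⟩ := he
              exact DirLift.ruled_comp h τ υ₂ j₂ hcomm _ e he _) K' hK''⟩
      · exact ⟨Tower.inv₂_cechRound_new₂ O k θ hθ P q Y hYirr hYcl hPnoeth hPreg Ch hChain hStep Z₉ hZ₉ υ' G G' γ T E K hE Z hZ υ₂ hinv hZET hfull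
            hsec hυ₂ hKcl hKE hKne hC hS K' (Or.inr ⟨hoff, hKst⟩),
          Tower.inv₂_cechRound_old₂ O k θ hθ P q Y hYirr hYcl hPnoeth hPreg Ch hChain hStep Z₉ hZ₉ υ' G G' γ T E K hE Z hZ υ₂ hinv hZET hfull
            hυ₂ hKcl hKE hKne hC hSo K' (Or.inr ⟨hoff, hKst⟩)⟩
  obtain ⟨hnew, hold⟩ := hboth
  have hG'int : IsIntegral G' := hnew.2.2.1
  haveI := hG'int
  -- the downstairs side facts of `K′` (res-D-pv-029's …NatTowerSideFacts)
  rcases hK' with rfl | ⟨-, rfl⟩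
  · exact ⟨⟨hnew, isClosed_empty, Set.empty_subset _, Set.empty_ne_univ⟩, ⟨hold, isClosed_empty, Set.empty_subset _, Set.empty_ne_univ⟩⟩
  · have hne : closure (υ₂ ⁻¹' (K \ Z)) ≠ Set.univ :=
      closure_preimage_ne_univ υ₂ _ hυ₂ K Z hKcl hKne hZ (fun h => hTZ (h ▸ Set.subset_univ _)) hZsupp.le _
        (Set.preimage_mono fun z hz => hz.1)
    refine ⟨⟨hnew, isClosed_closure, closure_preimage_diff_subset_closure_diff_preimage υ₂ K Z, hne⟩,
      ⟨hold, isClosed_closure, ?_, hne⟩⟩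
    have h := closure_preimage_diff_subset_of_isBlowup υ₂ (vanishingIdeal (⟨Z, hZ⟩ : Closeds G)) hυ₂ K E hEcl hKE
    rw [hZsupp] at h
    exact h



end Summit.ResolutionOfSingularities.ResolutionOfSingularities.Cruxes.EquisingularLiftNat.Sections

end
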